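import Summits.HodgeConjecture.HodgeConjecture.Theorems.F0P3cStCharTSUpDom                    -- ★ p851529 (LH4-p01): brings `Ch12Sec5.EllipticData` (`up`, `DG`, `DH`, `regH`, `stConjH`, `IsTransfer`, `μG`, `μH`), the (UP-DEF) currency (`finTau`, `finKappaAt`, `IsLocalNormPair`, `IsLocalStablyConjH`, `IsLocalGRegular`, `Gqs`)
import Literature.NumberTheory.Rogawski1990.FinExplicitTransferFactorConjRight                -- ★ `finExplicitDelta_conj_right_all` (+ `…_left_all`, `finExplicitCollection`, `IsLocalDeltaTransfer`) — the `hC06` pin's letters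
import Literature.NumberTheory.Rogawski1990.FinWeylDiscriminantFactorisation                  -- ★ (N1) p852353: the closed forms of `D_G`, `D_H` in `normAbs` currency (the `eDG`∕`eDH` pins' letters)
import Literature.NumberTheory.Automorphic.TateLocalFactors                                   -- ★ `SchwartzBruhat`
import Mathlib.MeasureTheory.Integral.Bochner.Basic
import HarnessLib

/-!
# F0 · P3c · line LH6 «StCharTS» — ROAD «UP-TR», brick (P1) «UP-TR DATUM DICTIONARY»: the up-transfer identity (locally-bounded class) at the CONCRETE local data
# `(νQv, νHv, mHv, mQv, Δ‴_v, D_G, D_H)` ⇒ the same sentence in the §12.5 datum's fields `𝔇.up ∕ 𝔇.IsTransfer ∕ 𝔇.μG ∕ 𝔇.μH ∕ 𝔇.regH ∕ 𝔇.stConjH ∕ 𝔇.DH`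
# [Rogawski1990 §12.5 p. 183, the display «`α ↦ α^G` is the distribution `f ↦ ∫_H f^H(h) α(h) dh`»; Lemma 12.5.1]

Cell `pub/hodgecm-mathlib`, crux H413 = `stmt-HodgeConjecture-24833` (lane `--kind proof --supports stmt-HodgeConjecture-24833`), route HCCMUnconditional.  ROAD «UP-TR» (LEAD T14-21 «A»,
holder ∕ dealer F0P3-p02 (g23); ROAD-UP-TR v2 §A (A-1)…(A-6), §D D1), DEAL #3h (P1) → LH3-p02 (g7).  THEOREMS ONLY (no definition ∕ instance ∕ notation ∕ named fact ∕ `sorry`); ★-only imports.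
Count-neutral: the block consequent `hUpTr` leaves the named block only at the UP-TR rider edition of RUNG 0.

WHAT.  The terminal head of the road, (A1′) `UpTransferLB` (holder), is ANALYSIS on the concrete local objects at a non-split finite place `v` of the CM field `L`: the Haar measures
`νQv` on `G_v = U(Φ₃)(L⁺_v)` and `νHv` on `H_v = (U(Φ₂) × U(Φ₁))(L⁺_v)`, the canonical orbital-measure families `mQv`, `mHv`, Rogawski's explicit transfer factor `Δ‴_v` (★
`finExplicitCollection`), the Weyl discriminants `D_G`, `D_H` in closed `normAbs` form (the `eDG`∕`eDH` pins of ★ RUNG 0 v5), and the up-map `α ↦ α^G` SPELLED INLINE by its (UP-DEF)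
formula `α^G(x) = D_G(x)⁻¹ · Σ_{q} τ(q) D_H(q) κ(q, x) α(q)` (sum over the `G`-regular stable classes `q` of `H_v` with `q ↔ x`; Lemma 12.5.1 in transfer-factor form).  The junction ∕ RUNG-0
rider, on the other hand, reads the consequent in the FIELDS of the §12.5 datum `𝔇 : Ch12Sec5.EllipticData G_v H_v` under the pins `hC01 hC02 hC06 eDG eDH hStH hRegH hUp` (★
`F0P3cStCharTSRung0Five` :152–:176, texts verbatim).  This file is the DICTIONARY between the two — pure pin rewriting, no analysis — so that the analytic core (A1′) never sees `𝔇`: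
* `upTransferLB_of_concrete` — GIVEN the concrete identity «for every measurable `α : H_v → ℂ` that is a stable class function on the `G`-regular set (w.r.t. ★ `IsLocalStablyConjH`) with
  `D_H · α` LOCALLY BOUNDED on the `G`-regular set (ROAD v2 §D D1: the class of every packet character `χ_ρ`, ★ pin `hHBHP`), every `f ∈ SchwartzBruhat G_v` and every `Δ‴_v`-transfer
  `f^H` of `f` (★ `IsLocalDeltaTransfer … mHv mQv f^H f`) with `f · α^G ∈ L¹(νQv)` and `f^H · α ∈ L¹(νHv)`: `∫ f · α^G dνQv = ∫ f^H · α dνHv`», THEN the same sentence with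
  `𝔇.up α`, `𝔇.IsTransfer f f^H`, `𝔇.μG`, `𝔇.μH`, stability on `𝔇.regH` w.r.t. `𝔇.stConjH`, and the local bound on `𝔇.DH · α` — i.e. the block consequent `hUpTr` of ★ RUNG 0 v5 :258 with
  ONE binder inserted after the stability hypothesis: `(∀ C, IsCompact C → ∃ B, ∀ s ∈ C, s ∈ 𝔇.regH → ‖(𝔇.DH s : ℂ) * α s‖ ≤ B)` — the antecedent of clause 3 of ★ `Ch12Sec5.EllipticData.UpSpecLB` (p852414) and the `hUpTrLB` letter of the holder's plug `upSpecLB_of_upTransferLB`, token for token (at the junction it is the `hHBHP` pin's shape with `𝔇.packetCharH ρ ↦ α`, read through `eRegH`).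
  Proof: `hStH`∕`hRegH` carry stability from `𝔇.regH ⊇ {G-regular}` down to the `G`-regular set; `hUp` then `eDG`∕`eDH` rewrite `𝔇.up α` to the inline formula; `hC06` rewrites the
  transfer relation; `hC01`∕`hC02` the measures; `eDH` + `hRegH` the local bound (a `G`-regular `s` lies in `𝔇.regH`).
* `upTransfer_datum_iff_concrete` is NOT stated: only the direction the rider consumes is typed (the converse would need `𝔇.regH ⊆ {G-regular}`, which RUNG 0 does not pin).
HONEST LABEL: HC_CM is proved only modulo the 7 printed citations (2 remaining named inputs: hLiu418 = `stmt-HodgeConjecture-24832`, h413 = `stmt-HodgeConjecture-24833`) until rung 0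
closes; this file closes no organ and moves no consequent by itself (count-neutral); `hUpTr` leaves the named block only when (A1′) is ★ and the rider re-letters the consequent to the
locally-bounded class (map owner LH6-p01 ∕ LEAD, ROAD v2 §D D1).

## References
* [Rogawski1990] J. D. Rogawski, *Automorphic Representations of Unitary Groups in Three Variables*, Ann. of Math. Stud. 123 (1990): §12.5 p. 183 (the display defining `α ↦ α^G`
  as the distribution `f ↦ ∫ f^H α dh`; Lemma 12.5.1, its formula), §4.9 p. 55 (`D_G`, `D_H`, `τ`, the transfer `χ ↦ χ^G`), §4.3 (4.3.1) p. 43 (the transfer `f → f^H`).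
-/

set_option autoImplicit false
-- the mandated namespace has the single-problem summit's repeated segment (`HodgeConjecture.HodgeConjecture`)
set_option linter.dupNamespace false

noncomputable section

open NumberField IsDedekindDomain MeasureTheory
open scoped Matrix MatrixGroups NNReal Classical
open Literature.NumberTheory.Rogawski1990 Literature.NumberTheory.Automorphic Literature.NumberTheory.Automorphic.UnitaryGroup
open Literature.NumberTheory.GaloisRepresentations

namespace Summit.HodgeConjecture.HodgeConjecture.Cruxes.H413.F0P3cStCharTSUpTrDatumDict

variable (L : Type) [Field L] [NumberField L] [IsCMField L] (v : HeightOneSpectrum (𝓞 ↥(maximalRealSubfield L)))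

/-- **(P1) UP-TR DATUM DICTIONARY.**  At a §12.5 datum `𝔇` on `(G_v, H_v) = (U(Φ₃)(L⁺_v), (U(Φ₂) × U(Φ₁))(L⁺_v))` whose fields are pinned to the concrete local data by
`hC01` (`𝔇.μG = νQv`), `hC02` (`𝔇.μH = νHv`), `hC06` (`𝔇.IsTransfer φ f^H ↔` ★ `IsLocalDeltaTransfer` for `Δ‴_v`, `mHv`, `mQv`), `eDG`∕`eDH` (closed forms of `D_G`, `D_H`), `hStH`
(`𝔇.stConjH ↔` ★ `IsLocalStablyConjH`), `hRegH` (`G`-regular `⊆ 𝔇.regH`) and the (UP-DEF) field equation `hUp` (texts = ★ `F0P3cStCharTSRung0Five` :152–:176 verbatim): the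
UP-TRANSFER IDENTITY FOR THE LOCALLY-BOUNDED CLASS, stated on the concrete data with `α^G` spelled inline (hypothesis `hconcrete` — the head of (A1′) `UpTransferLB`), IMPLIES the same
identity in the datum's fields — the block consequent `hUpTr` of RUNG 0 v5 with the local-boundedness binder `∀ C compact, ∃ B, ∀ s ∈ C, s ∈ 𝔇.regH → ‖D_H(s) · α(s)‖ ≤ B`
inserted after the stability hypothesis (= the `hUpTrLB` letter of `upSpecLB_of_upTransferLB`, clause 3 of ★ `UpSpecLB` p852414; ROAD «UP-TR» v2 §D D1, LEAD T14-26 (W1)).  Pure pin rewriting. [cite: Rogawski1990, §12.5 p. 183; Lemma 12.5.1 p. 183; §4.9 p. 55; §4.3 (4.3.1) p. 43] -/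
theorem upTransferLB_of_concrete (μ : HeckeCharacter L)
    [MeasurableSpace (Gqs L v)] [∀ γ : Gqs L v, MeasurableSpace (Gqs L v ⧸ Subgroup.centralizer ({γ} : Set (Gqs L v)))]
    [MeasurableSpace (Gqs L v ⧸ Subgroup.center (Gqs L v))]
    [MeasurableSpace ((UnitaryGroup.cmDatum L 2 (Matrix.of fun i j : Fin 2 => if i.val + j.val + 1 = 2 then (1 : L) else 0)).Local v ×
      (UnitaryGroup.cmDatum L 1 (Matrix.of fun i j : Fin 1 => if i.val + j.val + 1 = 1 then (1 : L) else 0)).Local v)]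
    [∀ a : ((UnitaryGroup.cmDatum L 2 (Matrix.of fun i j : Fin 2 => if i.val + j.val + 1 = 2 then (1 : L) else 0)).Local v ×
      (UnitaryGroup.cmDatum L 1 (Matrix.of fun i j : Fin 1 => if i.val + j.val + 1 = 1 then (1 : L) else 0)).Local v),
      MeasurableSpace (((UnitaryGroup.cmDatum L 2 (Matrix.of fun i j : Fin 2 => if i.val + j.val + 1 = 2 then (1 : L) else 0)).Local v ×
        (UnitaryGroup.cmDatum L 1 (Matrix.of fun i j : Fin 1 => if i.val + j.val + 1 = 1 then (1 : L) else 0)).Local v) ⧸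
        Subgroup.centralizer ({a} : Set ((UnitaryGroup.cmDatum L 2 (Matrix.of fun i j : Fin 2 => if i.val + j.val + 1 = 2 then (1 : L) else 0)).Local v ×
          (UnitaryGroup.cmDatum L 1 (Matrix.of fun i j : Fin 1 => if i.val + j.val + 1 = 1 then (1 : L) else 0)).Local v)))]
    (νHv : Measure ((UnitaryGroup.cmDatum L 2 (Matrix.of fun i j : Fin 2 => if i.val + j.val + 1 = 2 then (1 : L) else 0)).Local v ×
      (UnitaryGroup.cmDatum L 1 (Matrix.of fun i j : Fin 1 => if i.val + j.val + 1 = 1 then (1 : L) else 0)).Local v))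
    (νQv : Measure (Gqs L v))
    (mHv : OrbitalMeasureFamily ((UnitaryGroup.cmDatum L 2 (Matrix.of fun i j : Fin 2 => if i.val + j.val + 1 = 2 then (1 : L) else 0)).Local v ×
      (UnitaryGroup.cmDatum L 1 (Matrix.of fun i j : Fin 1 => if i.val + j.val + 1 = 1 then (1 : L) else 0)).Local v))
    (mQv : OrbitalMeasureFamily (Gqs L v))
    (𝔇 : Ch12Sec5.EllipticData (Gqs L v)
      ((UnitaryGroup.cmDatum L 2 (Matrix.of fun i j : Fin 2 => if i.val + j.val + 1 = 2 then (1 : L) else 0)).Local v ×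
        (UnitaryGroup.cmDatum L 1 (Matrix.of fun i j : Fin 1 => if i.val + j.val + 1 = 1 then (1 : L) else 0)).Local v))
    -- the pins (★ RUNG 0 v5 `hC01 hC02 hC06 eDG eDH hStH hRegH hUp`, texts verbatim)
    (hC01 : 𝔇.μG = νQv) (hC02 : 𝔇.μH = νHv)
    (hC06 : ∀ (φ : Gqs L v → ℂ) (fH : ((UnitaryGroup.cmDatum L 2 (Matrix.of fun i j : Fin 2 => if i.val + j.val + 1 = 2 then (1 : L) else 0)).Local v ×
        (UnitaryGroup.cmDatum L 1 (Matrix.of fun i j : Fin 1 => if i.val + j.val + 1 = 1 then (1 : L) else 0)).Local v) → ℂ),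
      𝔇.IsTransfer φ fH ↔
        IsLocalDeltaTransfer L (qsForm L) v
          ((finExplicitCollection L (qsForm L) μ (finExplicitDelta_conj_left_all L (qsForm L) μ) (finExplicitDelta_conj_right_all L (qsForm L) μ)) v) mHv mQv fH φ)
    (eDG : ∀ g : Gqs L v, 𝔇.DG g =
      ((NNReal.sqrt (NNReal.sqrt ((∏ w : PlacesOver L v, IsNonarchimedeanLocalField.normAbs (w.1.adicCompletion L) (((g.val : GL (Fin 3) (UnitaryGroup.LocalRing L v)).val.charpoly.discr) w)) *
        ((∏ w : PlacesOver L v, IsNonarchimedeanLocalField.normAbs (w.1.adicCompletion L) (((g.val : GL (Fin 3) (UnitaryGroup.LocalRing L v)).val.det) w)) ^ 2)⁻¹)) : ℝ≥0) : ℝ))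
    (eDH : ∀ s : ((UnitaryGroup.cmDatum L 2 (Matrix.of fun i j : Fin 2 => if i.val + j.val + 1 = 2 then (1 : L) else 0)).Local v ×
        (UnitaryGroup.cmDatum L 1 (Matrix.of fun i j : Fin 1 => if i.val + j.val + 1 = 1 then (1 : L) else 0)).Local v), 𝔇.DH s =
      ((NNReal.sqrt (NNReal.sqrt ((∏ w : PlacesOver L v, IsNonarchimedeanLocalField.normAbs (w.1.adicCompletion L) (((s.1.val : GL (Fin 2) (UnitaryGroup.LocalRing L v)).val.charpoly.discr) w)) *
        (∏ w : PlacesOver L v, IsNonarchimedeanLocalField.normAbs (w.1.adicCompletion L) (((s.1.val : GL (Fin 2) (UnitaryGroup.LocalRing L v)).val.det) w))⁻¹)) : ℝ≥0) : ℝ))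
    (hStH : ∀ a b : ((UnitaryGroup.cmDatum L 2 (Matrix.of fun i j : Fin 2 => if i.val + j.val + 1 = 2 then (1 : L) else 0)).Local v ×
        (UnitaryGroup.cmDatum L 1 (Matrix.of fun i j : Fin 1 => if i.val + j.val + 1 = 1 then (1 : L) else 0)).Local v), 𝔇.stConjH a b ↔ IsLocalStablyConjH L v a b)
    (hRegH : ∀ a : ((UnitaryGroup.cmDatum L 2 (Matrix.of fun i j : Fin 2 => if i.val + j.val + 1 = 2 then (1 : L) else 0)).Local v ×
        (UnitaryGroup.cmDatum L 1 (Matrix.of fun i j : Fin 1 => if i.val + j.val + 1 = 1 then (1 : L) else 0)).Local v), IsLocalGRegular L v a → a ∈ 𝔇.regH)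
    (hUp : ∀ (α : ((UnitaryGroup.cmDatum L 2 (Matrix.of fun i j : Fin 2 => if i.val + j.val + 1 = 2 then (1 : L) else 0)).Local v ×
        (UnitaryGroup.cmDatum L 1 (Matrix.of fun i j : Fin 1 => if i.val + j.val + 1 = 1 then (1 : L) else 0)).Local v) → ℂ) (x : Gqs L v),
      𝔇.up α x =
        if IsRegularElt (x.val : GL (Fin 3) (UnitaryGroup.LocalRing L v)) then
          ((𝔇.DG x : ℂ))⁻¹ *
            ∑ᶠ q : Quot (IsLocalStablyConjH L v),
              (if IsLocalGRegular L v q.out ∧ IsLocalNormPair L (qsForm L) v q.out x then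
                finTau L v q.out μ * (𝔇.DH q.out : ℂ) * ((finKappaAt L v (qsForm L) q.out x : ℤ) : ℂ) * α q.out
              else 0)
        else 0)
    -- (A1′) `UpTransferLB`: the identity ON THE CONCRETE DATA, `α^G` spelled inline by (UP-DEF) with the closed forms of `D_G`, `D_H`
    (hconcrete : ∀ α : ((UnitaryGroup.cmDatum L 2 (Matrix.of fun i j : Fin 2 => if i.val + j.val + 1 = 2 then (1 : L) else 0)).Local v ×
        (UnitaryGroup.cmDatum L 1 (Matrix.of fun i j : Fin 1 => if i.val + j.val + 1 = 1 then (1 : L) else 0)).Local v) → ℂ,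
      Measurable α →
      Ch12Sec5.IsStableClassFunOn (IsLocalStablyConjH L v)
        {a : ((UnitaryGroup.cmDatum L 2 (Matrix.of fun i j : Fin 2 => if i.val + j.val + 1 = 2 then (1 : L) else 0)).Local v ×
          (UnitaryGroup.cmDatum L 1 (Matrix.of fun i j : Fin 1 => if i.val + j.val + 1 = 1 then (1 : L) else 0)).Local v) | IsLocalGRegular L v a} α →
      (∀ C : Set ((UnitaryGroup.cmDatum L 2 (Matrix.of fun i j : Fin 2 => if i.val + j.val + 1 = 2 then (1 : L) else 0)).Local v ×
          (UnitaryGroup.cmDatum L 1 (Matrix.of fun i j : Fin 1 => if i.val + j.val + 1 = 1 then (1 : L) else 0)).Local v), IsCompact C →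
        ∃ B : ℝ, ∀ s ∈ C, IsLocalGRegular L v s →
          ‖(((NNReal.sqrt (NNReal.sqrt ((∏ w : PlacesOver L v, IsNonarchimedeanLocalField.normAbs (w.1.adicCompletion L) (((s.1.val : GL (Fin 2) (UnitaryGroup.LocalRing L v)).val.charpoly.discr) w)) *
              (∏ w : PlacesOver L v, IsNonarchimedeanLocalField.normAbs (w.1.adicCompletion L) (((s.1.val : GL (Fin 2) (UnitaryGroup.LocalRing L v)).val.det) w))⁻¹)) : ℝ≥0) : ℝ) : ℂ) * α s‖ ≤ B) →
      ∀ f ∈ SchwartzBruhat (Gqs L v), ∀ fH : ((UnitaryGroup.cmDatum L 2 (Matrix.of fun i j : Fin 2 => if i.val + j.val + 1 = 2 then (1 : L) else 0)).Local v ×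
          (UnitaryGroup.cmDatum L 1 (Matrix.of fun i j : Fin 1 => if i.val + j.val + 1 = 1 then (1 : L) else 0)).Local v) → ℂ,
        IsLocalDeltaTransfer L (qsForm L) v
          ((finExplicitCollection L (qsForm L) μ (finExplicitDelta_conj_left_all L (qsForm L) μ) (finExplicitDelta_conj_right_all L (qsForm L) μ)) v) mHv mQv fH f →
        Integrable (fun g : Gqs L v => f g *
          (if IsRegularElt (g.val : GL (Fin 3) (UnitaryGroup.LocalRing L v)) then
            ((((NNReal.sqrt (NNReal.sqrt ((∏ w : PlacesOver L v, IsNonarchimedeanLocalField.normAbs (w.1.adicCompletion L) (((g.val : GL (Fin 3) (UnitaryGroup.LocalRing L v)).val.charpoly.discr) w)) *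
              ((∏ w : PlacesOver L v, IsNonarchimedeanLocalField.normAbs (w.1.adicCompletion L) (((g.val : GL (Fin 3) (UnitaryGroup.LocalRing L v)).val.det) w)) ^ 2)⁻¹)) : ℝ≥0) : ℝ) : ℂ))⁻¹ *
              ∑ᶠ q : Quot (IsLocalStablyConjH L v),
                (if IsLocalGRegular L v q.out ∧ IsLocalNormPair L (qsForm L) v q.out g then
                  finTau L v q.out μ *
                    (((NNReal.sqrt (NNReal.sqrt ((∏ w : PlacesOver L v, IsNonarchimedeanLocalField.normAbs (w.1.adicCompletion L) (((q.out.1.val : GL (Fin 2) (UnitaryGroup.LocalRing L v)).val.charpoly.discr) w)) *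
                      (∏ w : PlacesOver L v, IsNonarchimedeanLocalField.normAbs (w.1.adicCompletion L) (((q.out.1.val : GL (Fin 2) (UnitaryGroup.LocalRing L v)).val.det) w))⁻¹)) : ℝ≥0) : ℝ) : ℂ) *
                    ((finKappaAt L v (qsForm L) q.out g : ℤ) : ℂ) * α q.out
                else 0)
          else 0)) νQv →
        Integrable (fun h => fH h * α h) νHv →
        ∫ g, f g *
          (if IsRegularElt (g.val : GL (Fin 3) (UnitaryGroup.LocalRing L v)) then
            ((((NNReal.sqrt (NNReal.sqrt ((∏ w : PlacesOver L v, IsNonarchimedeanLocalField.normAbs (w.1.adicCompletion L) (((g.val : GL (Fin 3) (UnitaryGroup.LocalRing L v)).val.charpoly.discr) w)) *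
              ((∏ w : PlacesOver L v, IsNonarchimedeanLocalField.normAbs (w.1.adicCompletion L) (((g.val : GL (Fin 3) (UnitaryGroup.LocalRing L v)).val.det) w)) ^ 2)⁻¹)) : ℝ≥0) : ℝ) : ℂ))⁻¹ *
              ∑ᶠ q : Quot (IsLocalStablyConjH L v),
                (if IsLocalGRegular L v q.out ∧ IsLocalNormPair L (qsForm L) v q.out g then
                  finTau L v q.out μ *
                    (((NNReal.sqrt (NNReal.sqrt ((∏ w : PlacesOver L v, IsNonarchimedeanLocalField.normAbs (w.1.adicCompletion L) (((q.out.1.val : GL (Fin 2) (UnitaryGroup.LocalRing L v)).val.charpoly.discr) w)) *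
                      (∏ w : PlacesOver L v, IsNonarchimedeanLocalField.normAbs (w.1.adicCompletion L) (((q.out.1.val : GL (Fin 2) (UnitaryGroup.LocalRing L v)).val.det) w))⁻¹)) : ℝ≥0) : ℝ) : ℂ) *
                    ((finKappaAt L v (qsForm L) q.out g : ℤ) : ℂ) * α q.out
                else 0)
          else 0) ∂νQv = ∫ h, fH h * α h ∂νHv) :
    -- the `hUpTrLB` letter: the block consequent `hUpTr` of ★ RUNG 0 v5 :258 with the local-boundedness antecedent of ★ `UpSpecLB` clause 3 inserted (ROAD v2 §D D1, LEAD T14-26 (W1))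
    ∀ α : ((UnitaryGroup.cmDatum L 2 (Matrix.of fun i j : Fin 2 => if i.val + j.val + 1 = 2 then (1 : L) else 0)).Local v ×
        (UnitaryGroup.cmDatum L 1 (Matrix.of fun i j : Fin 1 => if i.val + j.val + 1 = 1 then (1 : L) else 0)).Local v) → ℂ,
      Measurable α → Ch12Sec5.IsStableClassFunOn 𝔇.stConjH 𝔇.regH α →
      (∀ C : Set ((UnitaryGroup.cmDatum L 2 (Matrix.of fun i j : Fin 2 => if i.val + j.val + 1 = 2 then (1 : L) else 0)).Local v ×
          (UnitaryGroup.cmDatum L 1 (Matrix.of fun i j : Fin 1 => if i.val + j.val + 1 = 1 then (1 : L) else 0)).Local v), IsCompact C →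
        ∃ B : ℝ, ∀ s ∈ C, s ∈ 𝔇.regH → ‖(𝔇.DH s : ℂ) * α s‖ ≤ B) →
        ∀ f ∈ SchwartzBruhat (Gqs L v), ∀ fH : ((UnitaryGroup.cmDatum L 2 (Matrix.of fun i j : Fin 2 => if i.val + j.val + 1 = 2 then (1 : L) else 0)).Local v ×
            (UnitaryGroup.cmDatum L 1 (Matrix.of fun i j : Fin 1 => if i.val + j.val + 1 = 1 then (1 : L) else 0)).Local v) → ℂ, 𝔇.IsTransfer f fH →
          Integrable (fun g => f g * 𝔇.up α g) 𝔇.μG → Integrable (fun h => fH h * α h) 𝔇.μH →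
          ∫ g, f g * 𝔇.up α g ∂𝔇.μG = ∫ h, fH h * α h ∂𝔇.μH := by
  intro α hαm hαst hLB f hf fH hT hIG hIH
  -- stability on `𝔇.regH` (w.r.t. `𝔇.stConjH`) ⇒ stability on the `G`-regular set (w.r.t. ★ `IsLocalStablyConjH`)
  have hst' : Ch12Sec5.IsStableClassFunOn (IsLocalStablyConjH L v)
      {a : ((UnitaryGroup.cmDatum L 2 (Matrix.of fun i j : Fin 2 => if i.val + j.val + 1 = 2 then (1 : L) else 0)).Local v ×
        (UnitaryGroup.cmDatum L 1 (Matrix.of fun i j : Fin 1 => if i.val + j.val + 1 = 1 then (1 : L) else 0)).Local v) | IsLocalGRegular L v a} α :=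
    ⟨fun γ hγ x => hαst.1 γ (hRegH γ hγ) x, fun γ hγ γ' h => hαst.2 γ (hRegH γ hγ) γ' ((hStH γ γ').2 h)⟩
  -- the local bound in closed form
  have hLB' : ∀ C : Set ((UnitaryGroup.cmDatum L 2 (Matrix.of fun i j : Fin 2 => if i.val + j.val + 1 = 2 then (1 : L) else 0)).Local v ×
      (UnitaryGroup.cmDatum L 1 (Matrix.of fun i j : Fin 1 => if i.val + j.val + 1 = 1 then (1 : L) else 0)).Local v), IsCompact C →
      ∃ B : ℝ, ∀ s ∈ C, IsLocalGRegular L v s →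
        ‖(((NNReal.sqrt (NNReal.sqrt ((∏ w : PlacesOver L v, IsNonarchimedeanLocalField.normAbs (w.1.adicCompletion L) (((s.1.val : GL (Fin 2) (UnitaryGroup.LocalRing L v)).val.charpoly.discr) w)) *
            (∏ w : PlacesOver L v, IsNonarchimedeanLocalField.normAbs (w.1.adicCompletion L) (((s.1.val : GL (Fin 2) (UnitaryGroup.LocalRing L v)).val.det) w))⁻¹)) : ℝ≥0) : ℝ) : ℂ) * α s‖ ≤ B := by
    intro C hC
    obtain ⟨B, hB⟩ := hLB C hC
    exact ⟨B, fun s hs hreg => by rw [← eDH s]; exact hB s hs (hRegH s hreg)⟩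
  -- `𝔇.up α` in closed form
  have hup : (fun g : Gqs L v => f g * 𝔇.up α g) = fun g : Gqs L v => f g *
      (if IsRegularElt (g.val : GL (Fin 3) (UnitaryGroup.LocalRing L v)) then
        ((((NNReal.sqrt (NNReal.sqrt ((∏ w : PlacesOver L v, IsNonarchimedeanLocalField.normAbs (w.1.adicCompletion L) (((g.val : GL (Fin 3) (UnitaryGroup.LocalRing L v)).val.charpoly.discr) w)) *
          ((∏ w : PlacesOver L v, IsNonarchimedeanLocalField.normAbs (w.1.adicCompletion L) (((g.val : GL (Fin 3) (UnitaryGroup.LocalRing L v)).val.det) w)) ^ 2)⁻¹)) : ℝ≥0) : ℝ) : ℂ))⁻¹ *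
          ∑ᶠ q : Quot (IsLocalStablyConjH L v),
            (if IsLocalGRegular L v q.out ∧ IsLocalNormPair L (qsForm L) v q.out g then
              finTau L v q.out μ *
                (((NNReal.sqrt (NNReal.sqrt ((∏ w : PlacesOver L v, IsNonarchimedeanLocalField.normAbs (w.1.adicCompletion L) (((q.out.1.val : GL (Fin 2) (UnitaryGroup.LocalRing L v)).val.charpoly.discr) w)) *
                  (∏ w : PlacesOver L v, IsNonarchimedeanLocalField.normAbs (w.1.adicCompletion L) (((q.out.1.val : GL (Fin 2) (UnitaryGroup.LocalRing L v)).val.det) w))⁻¹)) : ℝ≥0) : ℝ) : ℂ) *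
                ((finKappaAt L v (qsForm L) q.out g : ℤ) : ℂ) * α q.out
            else 0)
      else 0) := by
    funext g
    simp only [hUp, eDG, eDH]
  rw [hC06] at hT
  rw [hup, hC01] at hIG
  rw [hC02] at hIH
  rw [hup, hC01, hC02]
  exact hconcrete α hαm hst' hLB' f hf fH hT hIG hIH

end Summit.HodgeConjecture.HodgeConjecture.Cruxes.H413.F0P3cStCharTSUpTrDatumDict

end
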